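import Mathlib
import HarnessLib
import Literature.Analysis.FluidPDE.PressurePoisson
import Literature.Analysis.FluidPDE.TaoEnstrophyLocalisationProofs
import Literature.Analysis.FluidPDE.TaoEnstrophyLocalisation
import Literature.Analysis.FluidPDE.ElgindiBlowup
import Summits.NavierStokesRegularity.NavierStokesRegularity.Theorems.LocalPressureProfileDoorMonotonePressureProfileRigiditySmallSliceKernel
import Summits.NavierStokesRegularity.NavierStokesRegularity.Theorems.LocalPressureProfileDoorMonotonePressureProfileRigiditySmallSliceHead
import Summits.NavierStokesRegularity.NavierStokesRegularity.Theorems.LocalPressureProfileDoorMonotonePressureProfileRigiditySmallSliceFrozen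

/-!
# Route `LocalPressureProfileDoor`, crux K2⁺ `MonotonePressureProfileRigidity` (stmt-NavierStokesRegularity-20180),
# line `birth`, stub `stub_smallSliceOfMonotonePressure` — helper 4b: the three PAIRINGS against the apex kernel on a window

Cell ns-regularity-ideate, seat ns-pressure-K2-p1 (LEAD; helper file, lands `--supports stmt-NavierStokesRegularity-20180`).

For a classical solution `(v, p)` of Navier–Stokes (`ν = 1`, `f = 0`) on `(−∞,0)` with the scale-invariant apex bounds, and an
adapted backward kernel `G` of `∂ₜ + v·∇ − Δ` on `[−1,0)` with the upper Gaussian bound, on a window `(−1, b)`, `b < 0`: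

* `hasDerivAt_headPairing` — `A(t) = ∫ q_E(t) G(t)` (head field of `…SmallSliceHead`) is differentiable on the window with
  derivative `a'(t) = ∫ (∂ₜ + v·∇ − Δ)q_E · G`, and `a'` is continuous there;
* `hasDerivAt_frozenPairing` — for each `τ` in the window, `t ↦ Φ_τ(t) = ∫ q_τ(t) G(t)` (frozen slice of `…SmallSliceFrozen`) is
  differentiable AT `t = τ` with derivative `γ(τ) = ∫ (∂ₜ + v·∇ − Δ)q_τ(τ,·) · G(τ)`;
* `continuousOn_enstrophyPairing` — `H(t) = ∫ ‖curl v(t)‖² G(t)` is continuous on the window;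
* `head_add_frozen_density` — the POINTWISE cancellation `(∂ₜ+v·∇−Δ)q_E + (∂ₜ+v·∇−Δ)q_τ|_{τ=t} = −(−t)‖curl v‖²`
  (`…SmallSliceHead.headField_density` + `…SmallSliceFrozen.frozen_density_diag` + the pressure Poisson equation
  `Δp = ‖curl v‖² − |∇v|²_F`);
* `head_add_frozen_pairing` — hence `a'(t) + γ(t) = −(−t) H(t)` on the window.

WHAT THIS IS NOT: not a claim about Navier–Stokes regularity; calculus for the budget of the L stub
(bears_on LADDER-NS N0, rung N0-LocalTubeDoorPressureProfile).
-/

noncomputable section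

set_option linter.dupNamespace false -- the summit and its sub-problem share the name (CONVENTIONS §1)
set_option maxSynthPendingDepth 3 -- nested operator types `ℝ³ →L[ℝ] ℝ³ →L[ℝ] ℝ³`

namespace Summit.NavierStokesRegularity.NavierStokesRegularity.Theorems.LocalPressureProfileDoorMonotonePressureProfileRigiditySmallSlicePairings

open MeasureTheory Set Function Filter Metric Topology InnerProductSpace
open scoped ENNReal NNReal InnerProductSpace RealInnerProductSpace Laplacian ContDiff
open Literature.Analysis Literature.Analysis.FluidPDE
open Summit.NavierStokesRegularity.NavierStokesRegularity.Theorems.LocalPressureProfileDoorMonotonePressureProfileRigiditySmallSliceKernel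
open Summit.NavierStokesRegularity.NavierStokesRegularity.Theorems.LocalPressureProfileDoorMonotonePressureProfileRigiditySmallSliceHead
open Summit.NavierStokesRegularity.NavierStokesRegularity.Theorems.LocalPressureProfileDoorMonotonePressureProfileRigiditySmallSliceFrozen

/-! ### Integrability of bounded continuous functions against a kernel slice -/

/-- A continuous `f` with `|f| ≤ M` is integrable against an integrable nonnegative kernel slice. [folklore] -/
theorem integrable_mul_kernel {f g : EuclideanSpace ℝ (Fin 3) → ℝ} (hf : Continuous f) {M : ℝ} (hM : ∀ x, |f x| ≤ M)
    (hg : Integrable g) (hgc : Continuous g) : Integrable fun x => f x * g x := by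
  refine Integrable.mono' (hg.norm.const_mul M) (hf.aestronglyMeasurable.mul hgc.aestronglyMeasurable)
    (Eventually.of_forall fun x => ?_)
  rw [Real.norm_eq_abs, abs_mul, Real.norm_eq_abs]
  exact mul_le_mul_of_nonneg_right (hM x) (abs_nonneg _)

/-! ### The pressure Poisson equation in vorticity form -/

/-- **`Δp = ‖curl v‖² − |∇v|²_F`** for a classical solution of the unforced Navier–Stokes system on an open time set
(`Δp = −div((v·∇)v) = −tr(Dv∘Dv)` for `div v = 0`, and `|Dv|²_F = ‖curl v‖² + tr(Dv∘Dv)` on `ℝ³`). [cite: Tsai1998, (1.7)] -/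
theorem laplacian_pressure_eq_curl {S : Set ℝ} {v : ℝ → EuclideanSpace ℝ (Fin 3) → EuclideanSpace ℝ (Fin 3)}
    {p : ℝ → EuclideanSpace ℝ (Fin 3) → ℝ} (hcl : IsClassicalNSSolutionOn S 1 0 v p) (hS : IsOpen S)
    {t : ℝ} (ht : t ∈ S) (x : EuclideanSpace ℝ (Fin 3)) :
    (Δ (p t)) x = ‖curl (v t) x‖ ^ 2 - frobeniusNormSq (fderiv ℝ (v t) x) := by
  have h1 := laplacian_pressure_eq_of_isClassicalNSSolutionOn hcl (show t ∈ interior S by rwa [hS.interior_eq]) x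
  have hu2 : ContDiff ℝ 2 (v t) := (hcl.contDiff_velocity ht).of_le (by norm_cast)
  have h0 : VectorCalculus.divergence
      ((0 : ℝ → EuclideanSpace ℝ (Fin 3) → EuclideanSpace ℝ (Fin 3)) t) x = 0 := by
    simp [VectorCalculus.divergence, Pi.zero_def]
  rw [h1, h0, add_zero, divergence_convect_self_eq hu2 (hcl.divFree t ht),
    frobeniusNormSq_fderiv_eq_sq_norm_curl_add_trace]
  ring

/-! ### The pointwise cancellation of the two densities -/

/-- **Head density + frozen-slice density = −(−t)‖curl v‖².**  For a classical solution `(v, p)` on `(−∞,0)` and `t < 0`, with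
`q_E` the head field and `q_t` the slice frozen at `τ = t`:
`[∂ₜq_E + Dq_E(v) − Δq_E] + [∂ₜq_t + Dq_t(v) − Δq_t]_{diag} = −(−t)|Dv|²_F − (−t)Δp = −(−t)‖curl v‖²`
(`headField_density`, `frozen_density_diag`, `laplacian_pressure_eq_curl`): the pressure-gradient terms cancel EXACTLY — this is
the physical form of the Leray head identity `(∂ₛ + L)E + LP = −|Ω|²`. [cite: Tsai1998, (1.7)] -/
theorem head_add_frozen_density {v : ℝ → EuclideanSpace ℝ (Fin 3) → EuclideanSpace ℝ (Fin 3)}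
    {p : ℝ → EuclideanSpace ℝ (Fin 3) → ℝ} (hcl : IsClassicalNSSolutionOn (Iio 0) 1 0 v p)
    {qE : ℝ → EuclideanSpace ℝ (Fin 3) → ℝ} (hqE : ∀ t x, qE t x = (-t) / 2 * ‖v t x‖ ^ 2 + 1 / 2 * ⟪x, v t x⟫)
    {t : ℝ} (ht : t < 0) {qt : ℝ → EuclideanSpace ℝ (Fin 3) → ℝ}
    (hqt : ∀ s x, qt s x = (-t) * p t ((Real.sqrt (-t) / Real.sqrt (-s)) • x)) (x : EuclideanSpace ℝ (Fin 3)) :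
    (deriv (fun s => qE s x) t + fderiv ℝ (qE t) x (v t x) - (Δ (qE t)) x) +
      (deriv (fun s => qt s x) t + fderiv ℝ (qt t) x (v t x) - (Δ (qt t)) x) =
      -((-t) * ‖curl (v t) x‖ ^ 2) := by
  rw [headField_density hcl isOpen_Iio hqE ht x, frozen_density_diag hcl ht hqt x,
    laplacian_pressure_eq_curl hcl isOpen_Iio ht x]
  ring

/-! ### The head pairing on a window -/

/-- **The head pairing `A(t) = ∫ q_E(t) G(t)` on the window `(−1, b)`.**  Under the scale-invariant apex bounds for `v` and the
upper Gaussian bound for the kernel `G`: `A` has derivative `a'(t) = ∫ (∂ₜq_E + Dq_E(v) − Δq_E) G` at every `t ∈ (−1, b)`, and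
`a'` is continuous on `(−1, b)` (tree first variation `hasDerivAt_pairing_window` with the window bounds
`headField_window_bounds`; continuity by `continuousOn_pairing_window`). [folklore] -/
theorem hasDerivAt_headPairing {D L C₁ C₂ b : ℝ} {v : ℝ → EuclideanSpace ℝ (Fin 3) → EuclideanSpace ℝ (Fin 3)}
    {p : ℝ → EuclideanSpace ℝ (Fin 3) → ℝ} (hA : IsTypeIAncientMild D v) (hcl : IsClassicalNSSolutionOn (Iio 0) 1 0 v p)
    {G : ℝ → EuclideanSpace ℝ (Fin 3) → ℝ} (hK : IsAdaptedBackwardKernel 1 v (Ico (-1 : ℝ) 0) 0 0 G)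
    (hC₁ : 0 ≤ C₁) (hC₂ : 0 < C₂)
    (hup : ∀ t ∈ Ico (-1 : ℝ) 0, ∀ x : EuclideanSpace ℝ (Fin 3),
      G t x ≤ C₁ * (-t) ^ (-(3 : ℝ) / 2) * Real.exp (-(‖x‖ ^ 2) / (C₂ * (-t))))
    (hb : b < 0) (hD : 0 ≤ D) (hL : 0 ≤ L)
    (h0 : ∀ t < (0 : ℝ), ∀ x : EuclideanSpace ℝ (Fin 3), ‖v t x‖ ≤ D / (‖x‖ + Real.sqrt (-t)))
    (h1 : ∀ t < (0 : ℝ), ∀ x : EuclideanSpace ℝ (Fin 3), ‖fderiv ℝ (v t) x‖ ≤ L / (‖x‖ + Real.sqrt (-t)) ^ 2)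
    (h2 : ∀ t < (0 : ℝ), ∀ x : EuclideanSpace ℝ (Fin 3), ‖iteratedFDeriv ℝ 2 (v t) x‖ ≤ L / (‖x‖ + Real.sqrt (-t)) ^ 3)
    (h3 : ∀ t < (0 : ℝ), ∀ x : EuclideanSpace ℝ (Fin 3), ‖deriv (fun s => v s x) t‖ ≤ L / (‖x‖ + Real.sqrt (-t)) ^ 3)
    {qE : ℝ → EuclideanSpace ℝ (Fin 3) → ℝ} (hqE : ∀ t x, qE t x = (-t) / 2 * ‖v t x‖ ^ 2 + 1 / 2 * ⟪x, v t x⟫) :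
    (∀ t ∈ Ioo (-1 : ℝ) b, HasDerivAt (fun s => ∫ x, qE s x * G s x)
      (∫ x, (timeDerivWithin (Ioo (-1 : ℝ) b) qE t x + fderiv ℝ (qE t) x (v t x) - (Δ (qE t)) x) * G t x) t) ∧
    ContinuousOn (fun t => ∫ x, (timeDerivWithin (Ioo (-1 : ℝ) b) qE t x + fderiv ℝ (qE t) x (v t x) -
      (Δ (qE t)) x) * G t x) (Ioo (-1 : ℝ) b) := by
  set S : Set ℝ := Ioo (-1 : ℝ) b with hS_def
  have hS : IsOpen S := isOpen_Ioo
  have hUd : UniqueDiffOn ℝ S := hS.uniqueDiffOn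
  have hSI : S ⊆ Iio (0 : ℝ) := fun s hs => lt_trans hs.2 hb
  have hv : IsSmoothSpaceTimeOn S v := hcl.smooth_velocity.mono hSI
  have hq : IsSmoothSpaceTimeOn S qE := isSmoothSpaceTimeOn_headField hv hqE
  obtain ⟨M, hM⟩ := headField_window_bounds hcl isOpen_Iio hqE hD hL le_rfl hb hSI h0 h1 h2 h3
  refine ⟨fun t ht => hasDerivAt_pairing_window hA hK hC₁ hC₂ hup le_rfl hb hq hM ht, ?_⟩
  -- continuity of `a'`: the integrand field is jointly smooth and bounded on the window
  have hF : IsSmoothSpaceTimeOn S (fun t x => timeDerivWithin S qE t x + fderiv ℝ (qE t) x (v t x) - (Δ (qE t)) x) :=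
    ((hq.timeDerivWithin hUd).add ((hq.fderiv_slice hUd).clm_apply hv)).sub (hq.laplacian hUd)
  have hb0 : 0 < -b := by linarith
  have hvb : ∀ t ∈ S, ∀ x, ‖v t x‖ ≤ D / Real.sqrt (-b) := by
    intro t ht x
    refine (hA.norm_le (hSI ht) x).trans ?_
    exact div_le_div_of_nonneg_left hD (Real.sqrt_pos.2 hb0) (Real.sqrt_le_sqrt (by linarith [ht.2]))
  refine continuousOn_pairing_window hK hC₁ hC₂ hup le_rfl hb hF (M := M + M * (D / Real.sqrt (-b)) + M) ?_
  intro t ht x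
  obtain ⟨-, hDq, hΔq, htq⟩ := hM t ht x
  have e2 : |fderiv ℝ (qE t) x (v t x)| ≤ M * (D / Real.sqrt (-b)) := by
    rw [← Real.norm_eq_abs]
    exact ((fderiv ℝ (qE t) x).le_opNorm _).trans (mul_le_mul hDq (hvb t ht x) (norm_nonneg _)
      ((abs_nonneg _).trans (hM t ht x).1))
  calc |timeDerivWithin S qE t x + fderiv ℝ (qE t) x (v t x) - (Δ (qE t)) x|
      ≤ |timeDerivWithin S qE t x + fderiv ℝ (qE t) x (v t x)| + |(Δ (qE t)) x| := abs_sub _ _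
    _ ≤ (|timeDerivWithin S qE t x| + |fderiv ℝ (qE t) x (v t x)|) + |(Δ (qE t)) x| := by
        gcongr; exact abs_add_le _ _
    _ ≤ (M + M * (D / Real.sqrt (-b))) + M := by gcongr

/-! ### The frozen pairing at the diagonal -/

set_option maxHeartbeats 400000 in
/-- **The frozen pairing `Φ_τ(t) = ∫ q_τ(t) G(t)` is differentiable at `t = τ`** for every `τ` in the window `(−1, b)`, with
derivative `∫ (∂ₜq_τ + Dq_τ(v) − Δq_τ)(τ, ·) G(τ)` (tree first variation with the window bounds `frozen_window_bounds` from the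
scale-invariant bounds of the pressure slice `p(τ, ·)`). [folklore] -/
theorem hasDerivAt_frozenPairing {D C₁ C₂ b K : ℝ} {v : ℝ → EuclideanSpace ℝ (Fin 3) → EuclideanSpace ℝ (Fin 3)}
    {p : ℝ → EuclideanSpace ℝ (Fin 3) → ℝ} (hA : IsTypeIAncientMild D v) (hcl : IsClassicalNSSolutionOn (Iio 0) 1 0 v p)
    {G : ℝ → EuclideanSpace ℝ (Fin 3) → ℝ} (hK : IsAdaptedBackwardKernel 1 v (Ico (-1 : ℝ) 0) 0 0 G)
    (hC₁ : 0 ≤ C₁) (hC₂ : 0 < C₂)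
    (hup : ∀ t ∈ Ico (-1 : ℝ) 0, ∀ x : EuclideanSpace ℝ (Fin 3),
      G t x ≤ C₁ * (-t) ^ (-(3 : ℝ) / 2) * Real.exp (-(‖x‖ ^ 2) / (C₂ * (-t))))
    (hb : b < 0) (hK0 : 0 ≤ K)
    (hp : ∀ t < (0 : ℝ), ∀ z : EuclideanSpace ℝ (Fin 3), (‖z‖ + Real.sqrt (-t)) ^ 2 * |p t z| ≤ K ∧
      (‖z‖ + Real.sqrt (-t)) ^ 3 * ‖fderiv ℝ (p t) z‖ ≤ K ∧
      (‖z‖ + Real.sqrt (-t)) ^ 4 * ‖iteratedFDeriv ℝ 2 (p t) z‖ ≤ K)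
    {τ : ℝ} (hτ : τ ∈ Ioo (-1 : ℝ) b) {qτ : ℝ → EuclideanSpace ℝ (Fin 3) → ℝ}
    (hqτ : ∀ t x, qτ t x = (-τ) * p τ ((Real.sqrt (-τ) / Real.sqrt (-t)) • x)) :
    HasDerivAt (fun s => ∫ x, qτ s x * G s x)
      (∫ x, (timeDerivWithin (Ioo (-1 : ℝ) b) qτ τ x + fderiv ℝ (qτ τ) x (v τ x) - (Δ (qτ τ)) x) * G τ x) τ := by
  have hSI : Ioo (-1 : ℝ) b ⊆ Iio (0 : ℝ) := fun s hs => lt_trans hs.2 hb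
  have hτ0 : τ < 0 := hSI hτ
  have hpτ : ContDiff ℝ ∞ (p τ) := hcl.contDiff_pressure hτ0
  have hq : IsSmoothSpaceTimeOn (Ioo (-1 : ℝ) b) qτ := (isSmoothSpaceTimeOn_frozen hpτ hqτ).mono hSI
  have hbd := frozen_window_bounds le_rfl hb hτ hpτ hK0 (fun z => (hp τ hτ0 z).1) (fun z => (hp τ hτ0 z).2.1)
    (fun z => (hp τ hτ0 z).2.2) hqτ
  -- one constant for the four bounds
  set M : ℝ := max (max (K / (-b)) (K / (-b) ^ 2)) (3 * K / (-b) ^ 3) with hM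
  have hM' : ∀ t ∈ Ioo (-1 : ℝ) b, ∀ x, |qτ t x| ≤ M ∧ ‖fderiv ℝ (qτ t) x‖ ≤ M ∧ |(Δ (qτ t)) x| ≤ M ∧
      |timeDerivWithin (Ioo (-1 : ℝ) b) qτ t x| ≤ M := by
    intro t ht x
    obtain ⟨e0, e1, e2, e3⟩ := hbd t ht x
    exact ⟨e0.trans ((le_max_left _ _).trans (le_max_left _ _)),
      e1.trans ((le_max_right _ _).trans (le_max_left _ _)), e2.trans (le_max_right _ _),
      e3.trans ((le_max_right _ _).trans (le_max_left _ _))⟩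
  exact hasDerivAt_pairing_window hA hK hC₁ hC₂ hup le_rfl hb hq hM' hτ

/-! ### The enstrophy pairing -/

/-- **`H(t) = ∫ ‖curl v(t)‖² G(t)` is continuous on the window `(−1, b)`** (the field `‖curl v‖²` is jointly smooth,
`isSmoothSpaceTimeOn_curl`, and bounded by `16 L²/(−b)²` there, `norm_curl_le_four_mul`). [folklore] -/
theorem continuousOn_enstrophyPairing {L C₁ C₂ b : ℝ} {v : ℝ → EuclideanSpace ℝ (Fin 3) → EuclideanSpace ℝ (Fin 3)}
    {p : ℝ → EuclideanSpace ℝ (Fin 3) → ℝ} (hcl : IsClassicalNSSolutionOn (Iio 0) 1 0 v p)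
    {G : ℝ → EuclideanSpace ℝ (Fin 3) → ℝ} (hK : IsAdaptedBackwardKernel 1 v (Ico (-1 : ℝ) 0) 0 0 G)
    (hC₁ : 0 ≤ C₁) (hC₂ : 0 < C₂)
    (hup : ∀ t ∈ Ico (-1 : ℝ) 0, ∀ x : EuclideanSpace ℝ (Fin 3),
      G t x ≤ C₁ * (-t) ^ (-(3 : ℝ) / 2) * Real.exp (-(‖x‖ ^ 2) / (C₂ * (-t))))
    (hb : b < 0) (hL : 0 ≤ L)
    (h1 : ∀ t < (0 : ℝ), ∀ x : EuclideanSpace ℝ (Fin 3), ‖fderiv ℝ (v t) x‖ ≤ L / (‖x‖ + Real.sqrt (-t)) ^ 2) :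
    ContinuousOn (fun t => ∫ x, ‖curl (v t) x‖ ^ 2 * G t x) (Ioo (-1 : ℝ) b) := by
  have hSI : Ioo (-1 : ℝ) b ⊆ Iio (0 : ℝ) := fun s hs => lt_trans hs.2 hb
  have hv : IsSmoothSpaceTimeOn (Ioo (-1 : ℝ) b) v := hcl.smooth_velocity.mono hSI
  have hcurl0 : IsSmoothSpaceTimeOn (Ioo (-1 : ℝ) b) (fun t x => curl (v t) x) := by
    have h1 := hv.fderiv_slice isOpen_Ioo.uniqueDiffOn
    have h2 : ContDiffOn ℝ ∞ (curlCLM ∘ uncurry fun t x => fderiv ℝ (v t) x) (Ioo (-1 : ℝ) b ×ˢ univ) :=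
      curlCLM.contDiff.comp_contDiffOn h1
    exact h2
  have hcurl : IsSmoothSpaceTimeOn (Ioo (-1 : ℝ) b) (fun t x => ‖curl (v t) x‖ ^ 2) := hcurl0.norm_sq ℝ
  have hb0 : 0 < -b := by linarith
  refine continuousOn_pairing_window hK hC₁ hC₂ hup le_rfl hb hcurl (M := (4 * (L / (-b))) ^ 2) fun t ht x => ?_
  have ht0 : t < 0 := hSI ht
  have hσ : Real.sqrt (-b) ≤ ‖x‖ + Real.sqrt (-t) := by
    have := Real.sqrt_le_sqrt (show -b ≤ -t by linarith [ht.2]); linarith [norm_nonneg x]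
  have hDv : ‖fderiv ℝ (v t) x‖ ≤ L / (-b) := by
    refine (h1 t ht0 x).trans (div_le_div_of_nonneg_left hL (by positivity) ?_)
    calc -b = Real.sqrt (-b) ^ 2 := (Real.sq_sqrt hb0.le).symm
      _ ≤ (‖x‖ + Real.sqrt (-t)) ^ 2 := pow_le_pow_left₀ (Real.sqrt_nonneg _) hσ 2
  rw [abs_of_nonneg (sq_nonneg _)]
  have h4 := norm_curl_le_four_mul (v t) x
  have : ‖curl (v t) x‖ ≤ 4 * (L / (-b)) := h4.trans (by linarith)
  exact pow_le_pow_left₀ (norm_nonneg _) this 2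

/-! ### `a' + γ = −(−t) H` -/

/-- **The cancellation integrated against the kernel.**  With the head pairing derivative `a'(t)`, the frozen pairing derivative
`γ(t)` (both in the raw form delivered by the first variation on the window `(−1, b)`) and `H(t) = ∫ ‖curl v(t)‖² G(t)`:
`a'(t) + γ(t) = −(−t) H(t)` for `t ∈ (−1, b)` (integrate `head_add_frozen_density`; every integrand is bounded × `G(t)`).
[cite: Tsai1998, (1.7)] -/
theorem head_add_frozen_pairing {D b : ℝ} {v : ℝ → EuclideanSpace ℝ (Fin 3) → EuclideanSpace ℝ (Fin 3)}
    {p : ℝ → EuclideanSpace ℝ (Fin 3) → ℝ} (hA : IsTypeIAncientMild D v) (hcl : IsClassicalNSSolutionOn (Iio 0) 1 0 v p)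
    {G : ℝ → EuclideanSpace ℝ (Fin 3) → ℝ} (hK : IsAdaptedBackwardKernel 1 v (Ico (-1 : ℝ) 0) 0 0 G) (hb : b < 0)
    {qE : ℝ → EuclideanSpace ℝ (Fin 3) → ℝ} (hqE : ∀ t x, qE t x = (-t) / 2 * ‖v t x‖ ^ 2 + 1 / 2 * ⟪x, v t x⟫)
    {ME : ℝ} (hME : ∀ t ∈ Ioo (-1 : ℝ) b, ∀ x, |qE t x| ≤ ME ∧ ‖fderiv ℝ (qE t) x‖ ≤ ME ∧ |(Δ (qE t)) x| ≤ ME ∧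
      |timeDerivWithin (Ioo (-1 : ℝ) b) qE t x| ≤ ME)
    {t : ℝ} (ht : t ∈ Ioo (-1 : ℝ) b) {qt : ℝ → EuclideanSpace ℝ (Fin 3) → ℝ}
    (hqt : ∀ s x, qt s x = (-t) * p t ((Real.sqrt (-t) / Real.sqrt (-s)) • x))
    {Mt : ℝ} (hMt : ∀ s ∈ Ioo (-1 : ℝ) b, ∀ x, |qt s x| ≤ Mt ∧ ‖fderiv ℝ (qt s) x‖ ≤ Mt ∧ |(Δ (qt s)) x| ≤ Mt ∧
      |timeDerivWithin (Ioo (-1 : ℝ) b) qt s x| ≤ Mt) :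
    (∫ x, (timeDerivWithin (Ioo (-1 : ℝ) b) qE t x + fderiv ℝ (qE t) x (v t x) - (Δ (qE t)) x) * G t x) +
      (∫ x, (timeDerivWithin (Ioo (-1 : ℝ) b) qt t x + fderiv ℝ (qt t) x (v t x) - (Δ (qt t)) x) * G t x) =
      -((-t) * ∫ x, ‖curl (v t) x‖ ^ 2 * G t x) := by
  set S : Set ℝ := Ioo (-1 : ℝ) b with hS_def
  have hS : IsOpen S := isOpen_Ioo
  have hUd : UniqueDiffOn ℝ S := hS.uniqueDiffOn
  have hSI : S ⊆ Iio (0 : ℝ) := fun s hs => lt_trans hs.2 hb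
  have hSK : S ⊆ Ico (-1 : ℝ) 0 := fun s hs => ⟨hs.1.le, hSI hs⟩
  have ht0 : t < 0 := hSI ht
  have htK : t ∈ Ico (-1 : ℝ) 0 := hSK ht
  have hv : IsSmoothSpaceTimeOn S v := hcl.smooth_velocity.mono hSI
  have hGi : Integrable (G t) := hK.integrable htK
  have hGc : Continuous (G t) := (hK.contDiff_slice htK).continuous
  -- the drift bound on the slice
  have hD0 : 0 ≤ D := hA.nonneg
  set Cv : ℝ := D / Real.sqrt (-t) with hCv
  have hvt : ∀ x, ‖v t x‖ ≤ Cv := fun x => hA.norm_le ht0 x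
  -- the two raw integrand fields are continuous in `x` and bounded
  have hqEs : IsSmoothSpaceTimeOn S qE := isSmoothSpaceTimeOn_headField hv hqE
  have hqts : IsSmoothSpaceTimeOn S qt := (isSmoothSpaceTimeOn_frozen (hcl.contDiff_pressure ht0) hqt).mono hSI
  have hcontF : ∀ {q : ℝ → EuclideanSpace ℝ (Fin 3) → ℝ}, IsSmoothSpaceTimeOn S q →
      Continuous fun x => timeDerivWithin S q t x + fderiv ℝ (q t) x (v t x) - (Δ (q t)) x := by
    intro q hq
    have hF : IsSmoothSpaceTimeOn S (fun s x => timeDerivWithin S q s x + fderiv ℝ (q s) x (v s x) - (Δ (q s)) x) :=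
      ((hq.timeDerivWithin hUd).add ((hq.fderiv_slice hUd).clm_apply hv)).sub (hq.laplacian hUd)
    exact (hF.contDiff_slice ht).continuous
  have hbdF : ∀ {q : ℝ → EuclideanSpace ℝ (Fin 3) → ℝ} {M : ℝ},
      (∀ s ∈ S, ∀ x, |q s x| ≤ M ∧ ‖fderiv ℝ (q s) x‖ ≤ M ∧ |(Δ (q s)) x| ≤ M ∧ |timeDerivWithin S q s x| ≤ M) →
      ∀ x, |timeDerivWithin S q t x + fderiv ℝ (q t) x (v t x) - (Δ (q t)) x| ≤ M + M * Cv + M := by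
    intro q M hM x
    obtain ⟨h0, hDq, hΔq, htq⟩ := hM t ht x
    have hM0 : 0 ≤ M := (abs_nonneg _).trans h0
    have e2 : |fderiv ℝ (q t) x (v t x)| ≤ M * Cv := by
      rw [← Real.norm_eq_abs]
      exact ((fderiv ℝ (q t) x).le_opNorm _).trans (mul_le_mul hDq (hvt x) (norm_nonneg _) hM0)
    calc |timeDerivWithin S q t x + fderiv ℝ (q t) x (v t x) - (Δ (q t)) x|
        ≤ |timeDerivWithin S q t x + fderiv ℝ (q t) x (v t x)| + |(Δ (q t)) x| := abs_sub _ _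
      _ ≤ (|timeDerivWithin S q t x| + |fderiv ℝ (q t) x (v t x)|) + |(Δ (q t)) x| := by
          gcongr; exact abs_add_le _ _
      _ ≤ (M + M * Cv) + M := by gcongr
  have hiE := integrable_mul_kernel (hcontF hqEs) (hbdF hME) hGi hGc
  have hit := integrable_mul_kernel (hcontF hqts) (hbdF hMt) hGi hGc
  rw [← integral_add hiE hit, ← integral_const_mul, ← integral_neg]
  refine integral_congr_ae (Eventually.of_forall fun x => ?_)
  have key := head_add_frozen_density hcl hqE ht0 hqt x
  beta_reduce
  rw [timeDerivWithin_eq_deriv hS ht, timeDerivWithin_eq_deriv hS ht]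
  calc (deriv (fun s => qE s x) t + fderiv ℝ (qE t) x (v t x) - (Δ (qE t)) x) * G t x +
        (deriv (fun s => qt s x) t + fderiv ℝ (qt t) x (v t x) - (Δ (qt t)) x) * G t x
      = ((deriv (fun s => qE s x) t + fderiv ℝ (qE t) x (v t x) - (Δ (qE t)) x) +
          (deriv (fun s => qt s x) t + fderiv ℝ (qt t) x (v t x) - (Δ (qt t)) x)) * G t x := by ring
    _ = -((-t) * ‖curl (v t) x‖ ^ 2) * G t x := by rw [key]
    _ = -((-t) * (‖curl (v t) x‖ ^ 2 * G t x)) := by ring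

end Summit.NavierStokesRegularity.NavierStokesRegularity.Theorems.LocalPressureProfileDoorMonotonePressureProfileRigiditySmallSlicePairings

end
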